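import Literature.AlgebraicGeometry.Motives.PoincareUniversal.DualNumberRigidTranslate
import Literature.AlgebraicGeometry.Motives.AbelianVarietyDualNumberLiftPhiTheta
import Literature.AlgebraicGeometry.AbelianVarieties.MumfordFamilyFirstOrderCech
import Literature.AlgebraicGeometry.HodgeTheory.AbelianVarietyTangentOfDualNumberTorus
import Literature.AlgebraicGeometry.Motives.AbelianVarietyAmpleRiemannForm
import Literature.Geometry.Kaehler.ComplexTorusFirstOrderRigidity
import Literature.Geometry.Kaehler.ComplexTorusLineBundleFactor
import HarnessLib

/-!
# First-order rigidity of the Poincaré family: `ℂ[ε]`-points of `T × Â` satisfying the graph condition are constant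

Layer `Literature/AlgebraicGeometry/Motives/PoincareUniversal`, namespace `Literature.AlgebraicGeometry.Motives.AbelianVariety`.
THEOREMS ONLY (no definition, no named fact, no instance).  Node N3d of the M13 programme (road «universal property of
the Poincaré bundle», [MumfordAV1970] §13, proof of the Theorem pp. 125–130: the Kodaira–Spencer map of the Mumford family
`Λ(𝒪(Θ))` is injective, «`Lie K(Θ) = 0`»), assembled from the tree:

* **`eq_toUnit_comp_of_pullback_mumfordSheaf_iso`** — «`Lie K(Θ) = 0`» for `Θ` ample: a `ℂ[ε]`-point `w` of `A₀` along
  which `(1 × w)^*Λ(𝒪(Θ)) ≅ pr₁^*N` for a rank-one `N` is CONSTANT.  Road (analytic): uniformise `A₀(ℂ) = V/Λ` with a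
  Riemann form for `𝒪(Θ)^an` (★ `exists_uniformisation_isRiemannForm_of_isAmple`, [Lange2023AbelianVarietiesComplex]
  Prop. 2.1.11), translate `w` through the origin, take its tangent vector `v ∈ V` (★
  `existsUnique_tangentVector_of_dualNumber`), read the first-order triviality in Čech form at closed points on a charted
  refinement (★ `exists_charted_firstOrderCech_of_iso`), transport the `ε`-parts to derivatives `∂_v` on `V` (★
  `snd_dualNumberStalkHom_translation_eq_fderiv`) and conclude `v = 0` by the analytic heart (★
  `IsCoverFrame.eq_zero_of_periodic_firstOrder_coboundary_of_refinement`: a Riemann form has no first-order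
  translational symmetry), whence `w` is constant (★ `exists_eq_toUnit_comp_of_tangentVector_eq_zero`);
* **`dualNumber_rigid_of_graphCond`** / **`stub_M13_3d_dualNumber_rigid`** (the M13 SPEC v0 signature, token for
  token) — a `ℂ[ε]`-point `u = (t ∘ str, u₂)` of `T × Â` with constant `T`-coordinate satisfying the graph condition
  `GraphCond` (★ `PoincareUniversal/GraphCondition`) has constant `Â`-coordinate: lift `u₂` through the étale isogeny
  `φ_Θ` (★ `exists_lift_dualNumber_phiTheta`), read the graph condition as «`(1 × w)^*Λ(𝒪(Θ))` is a constant
  deformation» (★ `translateToMumford_of_graphCond`), apply the first theorem, push down by `φ_Θ`.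

Cell provenance (hodgecm-mathlib, M13 node N3d): r1 B-p16, r2 + junction + (b1) B-p19, b3 / read-out / custody B-p03,
(L1) B-typ01.

## References

* D. Mumford, *Abelian Varieties* (1970): §13, proof of the Theorem pp. 125–130. [MumfordAV1970]
* H. Lange, *Abelian Varieties over the Complex Numbers* (2023): §1.4.4 Thm. 1.4.15 (p. 43); §2.1 Prop. 2.1.11 (p. 80).
  [Lange2023AbelianVarietiesComplex]
* H. Lange, Ch. Birkenhake, *Complex Abelian Varieties* (1992): Lemma 2.1.1 and §1.1.5. [LangeBirkenhake1992]
-/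

set_option autoImplicit false

noncomputable section

universe u

open CategoryTheory CategoryTheory.Limits AlgebraicGeometry Topology Filter TopologicalSpace MonoidalCategory
open scoped Manifold ContDiff DualNumber
open Literature.AlgebraicGeometry.Motives (AlgPoints ComplexPoints SchemeOver AbelianVariety)
open Literature.AlgebraicGeometry.Motives.AlgPoints
open Literature.Geometry.Kaehler (ComplexTorus)
open Literature.NumberTheory.Transcendental Literature.NumberTheory.Transcendental.IsAnalytification
open Literature.AlgebraicGeometry.HodgeTheory

namespace Literature.AlgebraicGeometry.Motives.AbelianVariety

/-! ## «`Lie K(Θ) = 0`»: the Kodaira–Spencer map of the Mumford family is injective (analytic road) -/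

section Core

open CartesianMonoidalCategory
open Literature.AlgebraicGeometry.AbelianVarieties Literature.AlgebraicGeometry.Modules
open Literature.Geometry.Kaehler Literature.Geometry.Kaehler.ComplexTorus

variable (A₀ : AbelianVariety ℂ) {Θ : CartierDivisor A₀.X.left}

/-- **«`Lie K(Θ) = 0`» for ample `Θ`.**  A `ℂ[ε]`-point `w` of `A₀` along which the Mumford family is first-order
trivial (`(1 × w)^*Λ(𝒪(Θ)) ≅ pr₁^*N`, `N` of rank one) is constant: `w = x ∘ str`.  Uniformise `A₀(ℂ) = V/Λ` with a
Riemann form for `𝒪(Θ)^an`; translate `w` to `w₀` through the origin (`c` the `ℂ`-point under its base point); take the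
tangent vector `v ∈ V` of `w₀`; the charted first-order Čech read-out gives regular `h_a` on a refinement `V_a ⊆ U_{k(a)}`
with `δ g_{k(b)k(a)} = (h_b − h_a) g_{k(b)k(a)}` at all closed points, i.e. (`ε`-parts at translated points `=` `∂_v` on
`V`) the hypotheses of `IsCoverFrame.eq_zero_of_periodic_firstOrder_coboundary_of_refinement` for `L = 𝒪(Θ)^an`,
`H_a = h_a ∘ φ ∘ π`; positivity of the Riemann form gives `v = 0`, so `w₀`, hence `w`, is constant.
[cite: MumfordAV1970, §13 (proof of the Thm. pp. 125–130)] [cite: Lange2023AbelianVarietiesComplex, §1.4.4 Thm. 1.4.15 (p. 43) and §2.1 Prop. 2.1.11 (p. 80)]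
[cite: LangeBirkenhake1992, Lemma 2.1.1 and §1.1.5] -/
theorem eq_toUnit_comp_of_pullback_mumfordSheaf_iso (hamp : Θ.IsAmple) (w : dualNumberOver ⟶ A₀.X)
    (N : A₀.X.left.Modules) (hN : HasRank N 1)
    (e : Nonempty ((Scheme.Modules.pullback (A₀.X ◁ w).left).obj (mumfordSheaf A₀ Θ) ≅
      (Scheme.Modules.pullback (CartesianMonoidalCategory.fst A₀.X dualNumberOver).left).obj N)) :
    ∃ x : 𝟙_ (SchemeOver ℂ) ⟶ A₀.X, w = toUnit _ ≫ x := by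
  classical
  -- uniformisation with a positive Appell–Humbert datum for `𝒪(Θ)^an`
  obtain ⟨ι₀, _, _, Φ, φ, hφ, hφadd, p, hp, hR⟩ := exists_uniformisation_isRiemannForm_of_isAmple A₀ hamp
  -- translate `w` through the origin
  obtain ⟨c, hc⟩ := exists_point_pt_eq_dualNumberBasePt w
  obtain ⟨w₀, rfl⟩ : ∃ w₀ : dualNumberOver ⟶ A₀.X, w₀ ≫ A₀.translation c = w :=
    ⟨w ≫ A₀.translation c⁻¹, by rw [Category.assoc, translation_inv_comp_translation, Category.comp_id]⟩
  have hw₀ : dualNumberBasePt w₀ = origin A₀ := by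
    have hback : (A₀.translation c⁻¹).left.base (dualNumberBasePt (w₀ ≫ A₀.translation c)) = dualNumberBasePt w₀ := by
      rw [← dualNumberBasePt_comp, Category.assoc, translation_comp_translation_inv, Category.comp_id]
    rw [← hback, ← hc, translation_apply_pt, inv_mul_cancel, pt_one_eq_origin A₀]
  -- the algebraic socket (charted refinement) and the tangent vector
  obtain ⟨e'⟩ := e
  obtain ⟨α, V, k, hVU, hVc, h, hh⟩ := exists_charted_firstOrderCech_of_iso A₀ w₀ hw₀ c hN e'
  obtain ⟨v, hv, -⟩ := existsUnique_tangentVector_of_dualNumber hφ hφadd w₀ hw₀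
  -- the analytic side: `L = 𝒪(Θ)^an`, a frame, and the junction on the refinement `φ⁻¹V_a`
  set L := cartierDivisorLineBundle hφ Θ with hL
  obtain ⟨s, hs⟩ := ComplexTorus.exists_isCoverFrame L
  have hv0 : v = 0 := by
    refine hs.eq_zero_of_periodic_firstOrder_coboundary_of_refinement hp.symm hR v
      (V := fun a ↦ φ ⁻¹' {Q | Q.pt ∈ V a}) (k := k) (fun a x hx ↦ hVU a hx)
      (fun a ↦ hφ.isOpen_preimage (V a)) (fun x ↦ hVc (φ x))
      (H := fun a y ↦ evalOrZero (V a) (h a) (φ (cover Φ y))) ?_ ?_ ?_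
    · intro a
      exact differentiableOn_evalOrZero_comp_cover hφ (V a) (h a)
    · intro a n y _
      simp only [cover_add_latticeVec]
    · intro a b y ha hb
      have ha' : (φ (cover Φ y)).pt ∈ V a := ha
      have hb' : (φ (cover Φ y)).pt ∈ V b := hb
      have hka : (φ (cover Φ y)).pt ∈ Θ.U (k a) := hVU a ha'
      have hkb : (φ (cover Φ y)).pt ∈ Θ.U (k b) := hVU b hb'
      have hx : (A₀.translation (φ (cover Φ y))).left.base (dualNumberBasePt w₀) ∈ Θ.U (k b) ⊓ Θ.U (k a) := by
        rw [← dualNumberBasePt_comp, dualNumberBasePt_comp_translation w₀ hw₀]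
        exact ⟨hkb, hka⟩
      have key := snd_dualNumberStalkHom_translation_eq_fderiv hφadd w₀ hv y (Θ.U (k b) ⊓ Θ.U (k a)) hx
        (Θ.transFun (k b) (k a))
      rw [hh a b (φ (cover Φ y)) ha' hb' hx] at key
      have hne : (φ (cover Φ y)).eval (Θ.U (k b) ⊓ Θ.U (k a)) ⟨hkb, hka⟩ (Θ.transFun (k b) (k a)) ≠ 0 := by
        have h0 := L.coordChange_ne_zero (k a) (k b) (cover Φ y) ⟨hka, hkb⟩
        rwa [show L.coordChange (k a) (k b) (cover Φ y) =
            evalOrZero (Θ.U (k b) ⊓ Θ.U (k a)) (Θ.transFun (k b) (k a)) (φ (cover Φ y)) from rfl,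
          evalOrZero_of_mem _ (show (φ (cover Φ y)).pt ∈ Θ.U (k b) ⊓ Θ.U (k a) from ⟨hkb, hka⟩)] at h0
      show fderiv ℂ (fun y' ↦ evalOrZero (Θ.U (k b) ⊓ Θ.U (k a)) (Θ.transFun (k b) (k a)) (φ (cover Φ y'))) y v /
            evalOrZero (Θ.U (k b) ⊓ Θ.U (k a)) (Θ.transFun (k b) (k a)) (φ (cover Φ y)) =
          evalOrZero (V b) (h b) (φ (cover Φ y)) - evalOrZero (V a) (h a) (φ (cover Φ y))
      rw [← key, evalOrZero_of_mem _ (show (φ (cover Φ y)).pt ∈ Θ.U (k b) ⊓ Θ.U (k a) from ⟨hkb, hka⟩),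
        evalOrZero_of_mem _ hb', evalOrZero_of_mem _ ha', mul_div_cancel_right₀ _ hne]
  -- all `ε`-parts of `w₀` vanish: `w₀`, hence `w`, is constant
  rw [hv0] at hv
  obtain ⟨x, hx⟩ := exists_eq_toUnit_comp_of_tangentVector_eq_zero w₀ hv
  exact ⟨x ≫ A₀.translation c, by rw [hx, Category.assoc]⟩

end Core

/-! ## First-order rigidity: the M13 SPEC statement `stub_M13_3d_dualNumber_rigid` -/

section Head

open CartesianMonoidalCategory
open Literature.AlgebraicGeometry.AbelianSchemes Literature.AlgebraicGeometry.AbelianVarieties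
  Literature.AlgebraicGeometry.Modules

variable (A₀ : AbelianVariety ℂ) {Θ : CartierDivisor A₀.X.left} (hΘ : Θ.IsAmple)
  (P : (A₀.X ⊗ (A₀.dualOf Θ hΘ).X).left.Modules)
  (T' : SchemeOver ℂ) (ℒ : (AbelianSchemeOver.ofAbelianVariety A₀).RigidifiedLineBundle T'.hom)

/-- A test pair with constant first coordinate and lifted second coordinate, rebuilt from its projections.
[cite: MumfordAV1970, §13 (p. 125)] -/
theorem eq_lift_of_comp_fst_of_comp_snd {S : SchemeOver ℂ} (u : S ⟶ T' ⊗ (A₀.dualOf Θ hΘ).X)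
    {a : S ⟶ T'} {b : S ⟶ (A₀.dualOf Θ hΘ).X} (ha : u ≫ CartesianMonoidalCategory.fst _ _ = a)
    (hb : u ≫ CartesianMonoidalCategory.snd _ _ = b) : u = CartesianMonoidalCategory.lift a b := by
  apply CartesianMonoidalCategory.hom_ext
  · rw [CartesianMonoidalCategory.lift_fst, ha]
  · rw [CartesianMonoidalCategory.lift_snd, hb]

/-- **FIRST-ORDER RIGIDITY (`KS` injective).**  A `ℂ[ε]`-point `u` of `T × Â` with constant `T`-coordinate `t` satisfying
the graph condition has constant `Â`-coordinate: lift `u₂` to `w` on `A₀` through `φ_Θ`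
(`exists_lift_dualNumber_phiTheta`), read the graph condition as «`(1 × w)^*Λ(𝒪(Θ))` is a constant deformation»
(`translateToMumford_of_graphCond`), conclude `w` constant (`eq_toUnit_comp_of_pullback_mumfordSheaf_iso`), and push down
by `φ_Θ`.  (`_hnorm`, `_hℒ` are part of the SPEC signature and not needed here.)
[cite: MumfordAV1970, §13 (proof of the Thm. pp. 125–130)] [cite: Lange2023AbelianVarietiesComplex, §1.4.4 Thm. 1.4.15 (p. 43)] -/
theorem dualNumber_rigid_of_graphCond [P.IsQuasicoherent] (hP1 : HasRank P 1)
    (eP : Nonempty ((Scheme.Modules.pullback (AbelianVariety.Hom.toSchemeHom (A₀.oneProdPhiTheta hΘ))).obj P ≅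
      mumfordSheaf A₀ Θ))
    (_hnorm : Nonempty ((Scheme.Modules.pullback (sliceZero A₀ (A₀.dualOf Θ hΘ)).left).obj P ≅
      unitModule (A₀.dualOf Θ hΘ).X.left))
    (_hℒ : ℒ.FibrewisePicZero)
    (u : dualNumberOver ⟶ T' ⊗ (A₀.dualOf Θ hΘ).X)
    (t : 𝟙_ (SchemeOver ℂ) ⟶ T')
    (hu : u ≫ CartesianMonoidalCategory.fst _ _ = toUnit _ ≫ t) (hc : GraphCond A₀ hΘ P T' ℒ u) :
    ∃ y : 𝟙_ (SchemeOver ℂ) ⟶ (A₀.dualOf Θ hΘ).X, u ≫ CartesianMonoidalCategory.snd _ _ = toUnit _ ≫ y := by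
  -- r1: lift the `Â`-coordinate along `φ_Θ`
  obtain ⟨w, hw⟩ := exists_lift_dualNumber_phiTheta A₀ hΘ (u ≫ CartesianMonoidalCategory.snd _ _)
  -- rebuild `u = (t ∘ str, φ_Θ ∘ w)`
  have hu' : u = CartesianMonoidalCategory.lift (toUnit _ ≫ t) (w ≫ (A₀.phiTheta Θ hΘ).hom.hom.hom) :=
    eq_lift_of_comp_fst_of_comp_snd A₀ hΘ T' u hu hw.symm
  -- r2: the graph condition says `(1 × w)^*Λ(𝒪(Θ))` is a constant deformation
  have hc' : GraphCond A₀ hΘ P T' ℒ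
      (CartesianMonoidalCategory.lift (toUnit _ ≫ t) (w ≫ (A₀.phiTheta Θ hΘ).hom.hom.hom)) := hu' ▸ hc
  obtain ⟨N, hN1, hN⟩ := translateToMumford_of_graphCond A₀ hΘ P T' ℒ hP1 eP w t hc'
  -- core: `w` is constant
  obtain ⟨x, hx⟩ := eq_toUnit_comp_of_pullback_mumfordSheaf_iso A₀ hΘ w N hN1 hN
  refine ⟨x ≫ (A₀.phiTheta Θ hΘ).hom.hom.hom, ?_⟩
  rw [← hw, hx, Category.assoc]

/-- **`stub_M13_3d_dualNumber_rigid`** — the M13 SPEC v0 statement (node N3d), signature token for token, UNCONDITIONAL: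
first-order rigidity of the Poincaré family read through the graph condition (`dualNumber_rigid_of_graphCond`).
[cite: MumfordAV1970, §13 (proof of the Thm. pp. 125–130)] [cite: Lange2023AbelianVarietiesComplex, §1.4.4 Thm. 1.4.15 (p. 43)] -/
theorem stub_M13_3d_dualNumber_rigid [P.IsQuasicoherent] (hP1 : HasRank P 1)
    (eP : Nonempty ((Scheme.Modules.pullback (AbelianVariety.Hom.toSchemeHom (A₀.oneProdPhiTheta hΘ))).obj P ≅
      mumfordSheaf A₀ Θ))
    (hnorm : Nonempty ((Scheme.Modules.pullback (sliceZero A₀ (A₀.dualOf Θ hΘ)).left).obj P ≅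
      unitModule (A₀.dualOf Θ hΘ).X.left))
    (hℒ : ℒ.FibrewisePicZero)
    (u : dualNumberOver ⟶ T' ⊗ (A₀.dualOf Θ hΘ).X)
    (t : 𝟙_ (SchemeOver ℂ) ⟶ T')
    (hu : u ≫ CartesianMonoidalCategory.fst _ _ = toUnit _ ≫ t) (hc : GraphCond A₀ hΘ P T' ℒ u) :
    ∃ y : 𝟙_ (SchemeOver ℂ) ⟶ (A₀.dualOf Θ hΘ).X, u ≫ CartesianMonoidalCategory.snd _ _ = toUnit _ ≫ y :=
  dualNumber_rigid_of_graphCond A₀ hΘ P T' ℒ hP1 eP hnorm hℒ u t hu hc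

end Head

end Literature.AlgebraicGeometry.Motives.AbelianVariety

end
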